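import Literature.Probability.RandomPlanarGeometry.SLEImageDriverFunctional
import Literature.Probability.RandomPlanarGeometry.SLERestrictionCompensatorKappa
import HarnessLib

/-!
# Localisation of the image driving function `W̃_t = h_t(W_t)` of SLE_κ under a `*`-hull: the processes

[LSW] 2003 §5 / Lawler–Schramm–Werner (2001) Thm. 2.2 (locality of SLE₆): along the SLE_κ hulls and
a `*`-hull `A` not yet reached, the image driving value `W̃_t = W_t + L_A − L_{B_t}`
(`B_t = g_t(A) − W_t = slidHull W A t`, `L = starShift`; path functionals `LFnK`, `imageDrvFnK` of
`SLEImageDriverFunctional`) is, at `κ = 6`, a continuous local martingale with bracket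
`6 ∫₀ᵗ h_s'(W_s)² ds = 6 ∫₀ᵗ Φ'_{B_s}(0)² ds`. This file only sets up the LOCALISED PROCESSES on the
Wiener space (definitions with bodies, no theorem of substance), in the format of
`SLERestrictionProcessesKappa` / `SLERestrictionCompensatorKappa`:

* `LhatFnK κ hA hne n t` — the tapered constant term `L_{B_t} 𝟙{alive} · (1 ∧ (n+1) R_t)` (a
  modification of `LFnK` with continuous paths, equal to `LFnK` wherever the alive functional
  `R_t ≥ 1/(n+1)`, in particular before the localising time; cf. `DhatFnK`);
* `imgDrvFnK κ hA hne n t = W_t + L̂_0 − L̂_t` — the continuous modification of `W̃_t`, `= W̃_t`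
  before the localising time, `= 0` at `t = 0`;
* `capTimeK κ n` — the first time `|W_t| ≥ n + 1`; `imgLocTimeK κ hA hne n = Tₙ ∧ capTimeK`
  (`Tₙ = locTimeK` of `SLERestrictionProcessesKappa`: before it the slid hull is controlled,
  `Φ'_{B_t}(0) > cₙ`, `dist(0, B_t) > cₙ`; before `capTimeK` the driver is bounded);
* `imgMartK κ hA hne n` — the image driving process stopped at `imgLocTimeK` (Mathlib
  `stoppedProcess`), the localised martingale of the locality proof;
* `imgClockK κ hA hne n t = ∫₀ᵗ 𝟙{s ≤ imgLocTimeK} (D̂ⁿ⁺¹_s)² ds` — its bracket clock divided by `κ`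
  (`timeIntegral ∘ trunc` of `Literature.Analysis.FunctionSpaces`, `D̂ = DhatpK` the continuous
  modification of `Φ'_{B_s}(0)`), frozen after the localising time.

## References

* [LSW] 2003, §5 (W̃_t = h_t(W_t), (5.1)). [LawlerSchrammWerner2003Restriction]
* G. F. Lawler, O. Schramm, W. Werner, Acta Math. **187** (2001), Thm. 2.2. [LawlerSchrammWerner2001]
* G. F. Lawler (2005), §4.6.1, §6.3 Prop. 6.13. [Lawler2005]
-/

noncomputable section

open Set Filter Metric Function MeasureTheory
open _root_.Complex _root_.Topology
open Literature.Probability.Process (brownian preWienerMeasure)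
open Literature.Analysis.FunctionSpaces (timeIntegral trunc)
open scoped NNReal

namespace Literature.Probability.RandomPlanarGeometry

open Loewner PathOps

/-! ### The path functionals -/

section Functionals

variable (κ : ℝ≥0) {A : Set ℂ} (hA : IsStarHull A) (hne : A.Nonempty)

/-- **The tapered constant term** `L̂ⁿ_t = L_{B_t} 𝟙{alive} · min 1 ((n+1) R_t)`: a modification of
`LFnK` with continuous paths (`R_t → 0` at the death time while `L_{B_t}` stays locally bounded),
equal to `LFnK` wherever `R_t ≥ 1/(n+1)`. [folklore] -/
def LhatFnK (n : ℕ) (t : ℝ≥0) (υ : C(ℝ≥0, ℝ)) : ℝ :=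
  LFnK κ A t υ * min 1 (((n : ℝ) + 1) * RFnK κ hA hne t υ)

/-- **The continuous modification of the image driving function** `W̃_t = W_t + L_A − L_{B_t}`:
`imgDrvFnK n t υ = W_t + L̂ⁿ_0 − L̂ⁿ_t` (`= W̃_t` before the localising time, `= 0` at `t = 0`).
[cite: LawlerSchrammWerner2003Restriction, §5 (W̃_t = h_t(W_t))] -/
def imgDrvFnK (n : ℕ) (t : ℝ≥0) (υ : C(ℝ≥0, ℝ)) : ℝ :=
  drvK κ υ t + LhatFnK κ hA hne n 0 υ - LhatFnK κ hA hne n t υ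

variable {κ hA hne}

/-- Unfolding of `LhatFnK`. [folklore] -/
theorem LhatFnK_def (n : ℕ) (t : ℝ≥0) (υ : C(ℝ≥0, ℝ)) :
    LhatFnK κ hA hne n t υ = LFnK κ A t υ * min 1 (((n : ℝ) + 1) * RFnK κ hA hne t υ) := rfl

/-- Unfolding of `imgDrvFnK`. [folklore] -/
theorem imgDrvFnK_def (n : ℕ) (t : ℝ≥0) (υ : C(ℝ≥0, ℝ)) :
    imgDrvFnK κ hA hne n t υ = drvK κ υ t + LhatFnK κ hA hne n 0 υ - LhatFnK κ hA hne n t υ := rfl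

/-- `imgDrvFnK n 0 = 0` (`W_0 = 0`). [folklore] -/
@[simp] theorem imgDrvFnK_zero (n : ℕ) (υ : C(ℝ≥0, ℝ)) : imgDrvFnK κ hA hne n 0 υ = 0 := by
  rw [imgDrvFnK_def, drvK_zero]; ring

/-- **Where `R_t ≥ 1/(n+1)` the taper is inactive**: `L̂ⁿ_t = L_{B_t} 𝟙{alive}`. [folklore] -/
theorem LhatFnK_eq_of_le {n : ℕ} {t : ℝ≥0} {υ : C(ℝ≥0, ℝ)} (hR : locLevel n ≤ RFnK κ hA hne t υ) :
    LhatFnK κ hA hne n t υ = LFnK κ A t υ := by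
  have hn : (0 : ℝ) < (n : ℝ) + 1 := by positivity
  have h1 : 1 ≤ ((n : ℝ) + 1) * RFnK κ hA hne t υ := by
    have := mul_le_mul_of_nonneg_left hR hn.le
    rwa [locLevel, mul_one_div_cancel hn.ne'] at this
  rw [LhatFnK_def, min_eq_left h1, mul_one]

/-- `|L̂ⁿ_t| ≤ |L_{B_t} 𝟙{alive}|` (the taper lies in `[0, 1]`). [folklore] -/
theorem abs_LhatFnK_le (n : ℕ) (t : ℝ≥0) (υ : C(ℝ≥0, ℝ)) : |LhatFnK κ hA hne n t υ| ≤ |LFnK κ A t υ| := by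
  have hR := RFnK_nonneg (κ := κ) (hA := hA) (hne := hne) t υ
  have h0 : 0 ≤ min 1 (((n : ℝ) + 1) * RFnK κ hA hne t υ) := le_min zero_le_one (by positivity)
  have h1 : min 1 (((n : ℝ) + 1) * RFnK κ hA hne t υ) ≤ 1 := min_le_left _ _
  rw [LhatFnK_def, abs_mul, abs_of_nonneg h0]
  exact (mul_le_mul_of_nonneg_left h1 (abs_nonneg _)).trans_eq (mul_one _)

/-- `|L̂ⁿ_t| ≤ |L_{B_t} 𝟙{alive}| · (n+1) R_t` (the bound that kills `L̂` at the death time). [folklore] -/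
theorem abs_LhatFnK_le_mul (n : ℕ) (t : ℝ≥0) (υ : C(ℝ≥0, ℝ)) :
    |LhatFnK κ hA hne n t υ| ≤ |LFnK κ A t υ| * (((n : ℝ) + 1) * RFnK κ hA hne t υ) := by
  have hR := RFnK_nonneg (κ := κ) (hA := hA) (hne := hne) t υ
  have h0 : 0 ≤ min 1 (((n : ℝ) + 1) * RFnK κ hA hne t υ) := le_min zero_le_one (by positivity)
  rw [LhatFnK_def, abs_mul, abs_of_nonneg h0]
  exact mul_le_mul_of_nonneg_left (min_le_right _ _) (abs_nonneg _)

end Functionals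

/-! ### The processes on the Wiener space -/

section Processes

variable (κ : ℝ≥0) {A : Set ℂ} (hA : IsStarHull A) (hne : A.Nonempty)

/-- The image driving process (continuous modification) `ω ↦ imgDrvFnK n t (β(ω))`. [folklore] -/
def imgDrvP (n : ℕ) (t : ℝ≥0) (ω : ℝ≥0 → ℝ) : ℝ := imgDrvFnK κ hA hne n t (brownianCPath ω)

/-- **The cap time**: the first time `|W_t| ≥ n + 1` (hitting time of a closed set by the continuous
adapted process `|W|`). [folklore] -/
def capTimeK (n : ℕ) : (ℝ≥0 → ℝ) → WithTop ℝ≥0 :=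
  hittingAfter (fun t ω ↦ |drvK κ (brownianCPath ω) t|) (Ici ((n : ℝ) + 1)) 0

/-- **The localising time of the locality martingale**: `imgLocTimeK n = Tₙ ∧ capTimeK n`, before which
the slid hull is in the controlled class and the driver is bounded by `n + 1`.
[cite: LawlerSchrammWerner2003Restriction, §5 (localisation t < T)] -/
def imgLocTimeK (n : ℕ) (ω : ℝ≥0 → ℝ) : WithTop ℝ≥0 := min (locTimeK κ hA hne n ω) (capTimeK κ n ω)

/-- **The localised image driving process** `Mⁿ_t = W̃_{t ∧ imgLocTimeK n}` (Mathlib `stoppedProcess` of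
the continuous modification). [cite: LawlerSchrammWerner2001, Thm. 2.2 (W̃ stopped is a martingale at κ = 6)] -/
def imgMartK (n : ℕ) : ℝ≥0 → (ℝ≥0 → ℝ) → ℝ := stoppedProcess (imgDrvP κ hA hne n) (imgLocTimeK κ hA hne n)

/-- The bracket rate `(D̂ⁿ⁺¹_s)²` (`= Φ'_{B_s}(0)² = h_s'(W_s)²` before the localising time). [folklore] -/
def imgRateK (n : ℕ) (s : ℝ≥0) (ω : ℝ≥0 → ℝ) : ℝ := DhatpK κ hA hne (n + 1) s ω ^ 2

/-- **The bracket clock** `imgClockK n t = ∫₀ᵗ 𝟙{s ≤ imgLocTimeK n} (D̂ⁿ⁺¹_s)² ds` (so that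
`κ · imgClockK` is the bracket of `Mⁿ`; frozen after the localising time).
[cite: LawlerSchrammWerner2003Restriction, §5 (5.1) (the clock ∫ h_s'(W_s)² ds)] -/
def imgClockK (n : ℕ) : ℝ≥0 → (ℝ≥0 → ℝ) → ℝ :=
  timeIntegral (trunc (imgLocTimeK κ hA hne n) (imgRateK κ hA hne n))

variable {κ hA hne}

/-- Unfolding of `imgDrvP`. [folklore] -/
theorem imgDrvP_def (n : ℕ) (t : ℝ≥0) (ω : ℝ≥0 → ℝ) : imgDrvP κ hA hne n t ω = imgDrvFnK κ hA hne n t (brownianCPath ω) := rfl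

/-- `imgDrvP n 0 = 0`. [folklore] -/
@[simp] theorem imgDrvP_zero (n : ℕ) (ω : ℝ≥0 → ℝ) : imgDrvP κ hA hne n 0 ω = 0 := imgDrvFnK_zero n _

/-- `imgLocTimeK n ≤ Tₙ`. [folklore] -/
theorem imgLocTimeK_le_locTimeK (n : ℕ) (ω : ℝ≥0 → ℝ) : imgLocTimeK κ hA hne n ω ≤ locTimeK κ hA hne n ω :=
  min_le_left _ _

/-- `imgLocTimeK n ≤ capTimeK n`. [folklore] -/
theorem imgLocTimeK_le_capTimeK (n : ℕ) (ω : ℝ≥0 → ℝ) : imgLocTimeK κ hA hne n ω ≤ capTimeK κ n ω :=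
  min_le_right _ _

/-- `imgLocTimeK n ≤ n + 1`. [folklore] -/
theorem imgLocTimeK_le (n : ℕ) (ω : ℝ≥0 → ℝ) : imgLocTimeK κ hA hne n ω ≤ (((n : ℝ≥0) + 1 : ℝ≥0) : WithTop ℝ≥0) :=
  (imgLocTimeK_le_locTimeK n ω).trans (locTimeK_le n ω)

/-- `imgLocTimeK n` is finite. [folklore] -/
theorem imgLocTimeK_ne_top (n : ℕ) (ω : ℝ≥0 → ℝ) : imgLocTimeK κ hA hne n ω ≠ ⊤ :=
  ne_top_of_le_ne_top WithTop.coe_ne_top (imgLocTimeK_le n ω)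

/-- Unfolding of the stopped process. [folklore] -/
theorem imgMartK_apply (n : ℕ) (t : ℝ≥0) (ω : ℝ≥0 → ℝ) :
    imgMartK κ hA hne n t ω = imgDrvP κ hA hne n (min (t : WithTop ℝ≥0) (imgLocTimeK κ hA hne n ω)).untopA ω := rfl

/-- `Mⁿ_0 = 0`. [folklore] -/
@[simp] theorem imgMartK_zero (n : ℕ) (ω : ℝ≥0 → ℝ) : imgMartK κ hA hne n 0 ω = 0 := by
  rw [imgMartK_apply]
  have : (min ((0 : ℝ≥0) : WithTop ℝ≥0) (imgLocTimeK κ hA hne n ω)).untopA = 0 := by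
    rw [min_eq_left (by exact_mod_cast bot_le : ((0 : ℝ≥0) : WithTop ℝ≥0) ≤ imgLocTimeK κ hA hne n ω)]; rfl
  rw [this, imgDrvP_zero]

/-- Unfolding of the rate. [folklore] -/
theorem imgRateK_def (n : ℕ) (s : ℝ≥0) (ω : ℝ≥0 → ℝ) : imgRateK κ hA hne n s ω = DhatpK κ hA hne (n + 1) s ω ^ 2 := rfl

/-- `0 ≤ rate ≤ 1`. [folklore] -/
theorem imgRateK_mem_Icc (n : ℕ) (s : ℝ≥0) (ω : ℝ≥0 → ℝ) : imgRateK κ hA hne n s ω ∈ Icc (0 : ℝ) 1 := by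
  obtain ⟨h0, h1⟩ := DhatFnK_mem_Icc (κ := κ) (hA := hA) (hne := hne) (n + 1) s (brownianCPath ω)
  rw [imgRateK_def, DhatpK]
  exact ⟨sq_nonneg _, pow_le_one₀ h0 h1⟩

/-- Unfolding of the clock as an interval integral. [folklore] -/
theorem imgClockK_def (n : ℕ) (t : ℝ≥0) (ω : ℝ≥0 → ℝ) :
    imgClockK κ hA hne n t ω = ∫ s in (0 : ℝ)..t, trunc (imgLocTimeK κ hA hne n) (imgRateK κ hA hne n) s.toNNReal ω := rfl

/-- `imgClockK n 0 = 0`. [folklore] -/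
@[simp] theorem imgClockK_zero (n : ℕ) (ω : ℝ≥0 → ℝ) : imgClockK κ hA hne n 0 ω = 0 :=
  Literature.Analysis.FunctionSpaces.timeIntegral_apply_zero _ ω

/-- **The clock is frozen after the localising time**: `imgClockK n t = ∫₀^{t ∧ imgLocTimeK} rate`.
[folklore] -/
theorem imgClockK_eq_timeIntegral_min (n : ℕ) (t : ℝ≥0) (ω : ℝ≥0 → ℝ) :
    imgClockK κ hA hne n t ω =
      timeIntegral (imgRateK κ hA hne n) (min (t : WithTop ℝ≥0) (imgLocTimeK κ hA hne n ω)).untopA ω :=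
  Literature.Analysis.FunctionSpaces.timeIntegral_trunc _ _ t ω

end Processes

end Literature.Probability.RandomPlanarGeometry

end
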